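import Summits.BirchSwinnertonDyer.BirchSwinnertonDyer.Theorems.ByReductionTypeAtTwoSupersingularFlatCountTwoOfPrintV8
import Literature.NumberTheory.EllipticCurves.Sprung2024.ChromaticLocalInjectivityUncondProofs
import Literature.NumberTheory.EllipticCurves.Sprung2024.ChromaticSmallControlSurjProofs
import Literature.NumberTheory.EllipticCurves.Sprung2024.ChromaticEulerCharAssemblyProofs
import Literature.NumberTheory.EllipticCurves.Sprung2024.ChromaticCoinvariantsCard
import HarnessLib

/-!
# Sprung 2024 §5.2 Lemma 5.5 (all conductors) at an ODD supersingular prime — the count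
# `#ker g · #E(ℚ)_p = p^{ord_p ∏ c_ℓ} · #(Sel⋆(E/ℚ_∞))_Γ` — from THREE named facts of Greenberg LNM 1716 /
# Kato BY NAME (Prop. 4.13 = Cassels, Prop. 4.12, §5 p. 140 = Kato Thm. 12.4) and the kernel, modulo the
# `⋆`-local lift at `p`; and the `♭` colour in full

Cell `bsd-inputs` (D-0154 (2) INPUTS→UNCONDITIONAL), seat `bsd-inputs-l55-p1` (row 8, T3(i)); serves item
stmt-BirchSwinnertonDyer-19878 (`Sprung2024.lem59AllN_sharpFlatCharValue_rankZero`, route decls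
`SignedLowerHalves.SharpFlatCharValueRankZeroAllLevels`, `PrintX8VS.InputLem59AllN`), whose single residual after
`Sprung2024/ChromaticCharValueRankZeroProofs.lean` (`lem59AllN_of_lem55AllNcard_of_prop73_prop76`) is the named fact
`Sprung2024.lem55AllN_sharpFlat_coinvariants_card` (Sprung 2024 §5.2 Lemma 5.5 = Greenberg LNM 1716 Lemma 4.7 with
`Sel ↦ Sel⋆`). Its printed proof IS Cassels–Poitou–Tate + Prop. 4.12 + weak Leopoldt (LNM 1716 pp. 104–108,
119–122), none of which is a theorem of the tree; so no unconditional `_holds` is produced here. WHAT THIS FILE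
DOES: the bsd-2adic cell's COUNT♭@2 door (`SSFlatEC.flatCountTwo_of_print3`, file
`…ByReductionTypeAtTwoSupersingularFlatCountTwoOfPrintV8.lean`) sits on an engine that is GENERIC in the prime,
the number field and the colour (parts 1–15 and 19 of that series); this file assembles the SAME door at an odd
supersingular `p` for Sprung's genuine Honda systems (`Sprung2012.IsHondaSystem`, `c_{-1}` present):

* `sharpFlatCount_of_cassels_of_coinv` — bookkeeping: the count ⟸ `#E(ℚ)_p = 1` ∧ `#ker g = p^{ord ∏c}` ∧
  `#(Sel⋆_∞)_γ = 1` (either colour);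
* `sharpFlatCount_of_print_of_locp` — **either colour**: the body of `lem55AllN_sharpFlat_coinvariants_card`
  at `(W, p, κ, γ, v, g, cneg, c, col)` from the three named facts
  {`Greenberg1999.casselsSurjectivity_H1Sigma ℚ`, `Greenberg1999.prop412_noFiniteSubmodule_H1Sigma_of_rank_one`,
  `Greenberg1999.h1SigmaInfty_rank_eq_one`} + THEOREM (pp. 108 and 119–120 are the tree theorems
  `localQuotient_restriction_surjective_holds`, `SignedEC.H1SigmaCorank.h1Sigma_zpCorank_le_degree_holds_rat`;
  `#E(ℚ)_p = 1`, «`Ker Col⋆` kills `E(ℚ_p)`», «`r_p` injective», Lemma 2.3 are the kdot theorems of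
  `Sprung2024/Chromatic*Proofs`, `Sprung2012/*Proofs`), MODULO the displayed `⋆`-local lift `hlocp` at the place
  above `p` (Greenberg p. 108 «for `v ∣ p`»: `cd_p Γ_𝔭 = 1` + `(E⋆_∞)_Γ = 0`);
* `hlocp_flat_of_isHondaSystem` — the `♭`-local lift at `p` DISCHARGED (part 19 `SSFlatEC.exists_localLift_flat`
  verbatim; its clause «`z(c_0) = 0 ⇒ z = 0`» from the Honda relation `c_0 = (a_p − 2)c_{−1}` and the level-0
  generation on `c_{−1}`, `a_p − 2 ≠ 0`);
* `sharpFlatCount_flat_of_print` — **the `♭` colour in full**: Lemma 5.5 (all `N`) at `(p, ♭)` ⟸ the three named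
  facts, nothing displayed.

HONEST FRAMING: theorems only (no `def`); conditional on three EXISTING refereed named facts (trust base =
{Cassels 1964 / Greenberg Prop. 4.13, Greenberg Prop. 4.12, Kato Thm. 12.4}); the `♯` colour still displays `hlocp`
(the `♯` port of parts 16–19 is the sequel); item 19878 is NOT closed; no census cell moves; BSD is not proved
by any of this.

References: [Sprung2024] §5.2 Lemma 5.5 (p. 40); [GreenbergLNM1716] §4 pp. 104–108 (Lemmas 4.4–4.7), Appendix
Prop. 4.12, Prop. 4.13 / p. 122, pp. 119–120, §5 p. 140; [Kato2004Asterisque] Thm. 12.4; [Sprung2012] Thm. 2.2,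
Lemma 2.3, Def. 7.9–7.11; [RaySprung2025] p. 2343.
-/

set_option autoImplicit false
-- the Theorems namespace of this sub repeats the summit name by design (D-0017 nested layout)
set_option linter.dupNamespace false

noncomputable section

open scoped Classical NumberField

open NumberField IsDedekindDomain

namespace Summit.BirchSwinnertonDyer.BirchSwinnertonDyer.Theorems.SharpFlatCount

open Literature.NumberTheory.EllipticCurves Literature.NumberTheory.GaloisRepresentations
  WeierstrassCurve ZpExtension Literature.NumberTheory.EllipticCurves.Kobayashi2003
  Literature.NumberTheory.EllipticCurves.Sprung2017 Literature.NumberTheory.EllipticCurves.Sprung2012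
  Literature.NumberTheory.EllipticCurves.Sprung2024 Literature.NumberTheory.EllipticCurves.IwasawaDual
  Literature.NumberTheory.EllipticCurves.IwasawaAlgebra Literature.NumberTheory.EllipticCurves.GreenbergVatsal2000
  Literature.NumberTheory.EllipticCurves.Rank1Residual Summit.BirchSwinnertonDyer.Rank1Residual.X5.O1
  Summit.BirchSwinnertonDyer.Rank1Residual.X2
  Summit.BirchSwinnertonDyer.BirchSwinnertonDyer.Theorems.SSFlatEC

variable (W : WeierstrassCurve ℚ) [W.IsElliptic] [W.IsGloballyMinimal] (p : ℕ) [Fact p.Prime]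

omit [W.IsElliptic] in
/-- **Bookkeeping (Greenberg, LNM 1716, Lemma 4.7 with `E(F)_p = 0`), either colour.** If `#E[p^∞]^{Γ_ℚ} = 1`,
`Sel_{p^∞}(E/ℚ)` finite ⇒ `#ker g⋆ = p^{ord_p ∏ c_ℓ}` (Cassels' count) and `Sel` finite ⇒ `(Sel⋆_∞)_γ` finite ⇒
`#(Sel⋆_∞)_γ = 1`, then the displayed count of Lemma 5.5 holds. [cite: GreenbergLNM1716, §4 Lemma 4.7 (p. 107)] -/
theorem sharpFlatCount_of_cassels_of_coinv (κ : ZpExtension ℚ p) (γ : Field.absoluteGaloisGroup ℚ)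
    {v : HeightOneSpectrum (𝓞 ℚ)} (g : Field.absoluteGaloisGroup (v.adicCompletion ℚ))
    (c : ℕ → localPoints W (v.adicCompletion ℚ)) (col : Chroma)
    (htors : Nat.card (MulAction.fixedPoints (Field.absoluteGaloisGroup ℚ) (W.geomPrimaryTorsion p)) = 1)
    (hCassels : Finite (W.selmerGroupPInfty p) →
      Nat.card (↥((sharpFlatSelmerInfty W κ (closureEmb (K := ℚ) (v.adicCompletion ℚ))
            (W.frobeniusTrace p) g c col).comap (W.layerToInfty κ 0)) ⧸
          (W.selmerLayer κ 0).addSubgroupOf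
            ((sharpFlatSelmerInfty W κ (closureEmb (K := ℚ) (v.adicCompletion ℚ))
              (W.frobeniusTrace p) g c col).comap (W.layerToInfty κ 0))) =
        p ^ (padicValNat p W.tamagawaProduct))
    (hCoinv : Finite (W.selmerGroupPInfty p) →
      Finite (EndCoinvariants (conjSharpFlatSelmerInfty W κ (closureEmb (K := ℚ) (v.adicCompletion ℚ))
        (W.frobeniusTrace p) g c col γ - 1)) →
      Nat.card (EndCoinvariants (conjSharpFlatSelmerInfty W κ
          (closureEmb (K := ℚ) (v.adicCompletion ℚ)) (W.frobeniusTrace p) g c col γ - 1)) = 1) :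
    Finite (W.selmerGroupPInfty p) →
      Finite (EndCoinvariants (conjSharpFlatSelmerInfty W κ (closureEmb (K := ℚ) (v.adicCompletion ℚ))
        (W.frobeniusTrace p) g c col γ - 1)) →
      Nat.card (↥((sharpFlatSelmerInfty W κ (closureEmb (K := ℚ) (v.adicCompletion ℚ))
            (W.frobeniusTrace p) g c col).comap (W.layerToInfty κ 0)) ⧸
          (W.selmerLayer κ 0).addSubgroupOf
            ((sharpFlatSelmerInfty W κ (closureEmb (K := ℚ) (v.adicCompletion ℚ))
              (W.frobeniusTrace p) g c col).comap (W.layerToInfty κ 0))) *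
        Nat.card (MulAction.fixedPoints (Field.absoluteGaloisGroup ℚ) (W.geomPrimaryTorsion p)) =
      p ^ (padicValNat p W.tamagawaProduct) *
        Nat.card (EndCoinvariants (conjSharpFlatSelmerInfty W κ
          (closureEmb (K := ℚ) (v.adicCompletion ℚ)) (W.frobeniusTrace p) g c col γ - 1)) := by
  intro hfin hco
  rw [htors, hCassels hfin, hCoinv hfin hco]

/-- **«`z(c_0) = 0 ⇒ z = 0`» for a genuine Honda system at an odd supersingular prime.** In
`Sprung2012.IsHondaSystem` the level-`0` generation clause is stated on `c_{−1}` («`z(c_{−1}) = 0 ⇒ z = 0`»); since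
`c_0 = (a_p − 2)·c_{−1}` and the integer `a_p − 2` is non-zero (`p ∣ a_p`, `p` prime), the clause on `c_0` used by the
`p`-generic engine of the bsd-2adic series follows. [cite: Sprung2012, Thm. 2.2 (p. 1487)] -/
theorem evalOn_layerZero_eq_zero_imp_of_isHondaSystem {K : Type} [Field K] [NumberField K]
    (W : WeierstrassCurve K) {p : ℕ} [Fact p.Prime] (hp2 : p ≠ 2) (κ : ZpExtension K p) {E : Type} [Field E]
    [Algebra K E] (ι : AlgebraicClosure K →ₐ[K] AlgebraicClosure E) {ap : ℤ} (hap : (p : ℤ) ∣ ap)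
    {g : Field.absoluteGaloisGroup E} {cneg : localPoints W E} {c : ℕ → localPoints W E}
    (hH : IsHondaSystem κ ι W ap g cneg c)
    (z₀ : localLayerPointsOfEmb κ ι W 0 →+ ℤ_[p])
    (hz : evalOn W (localLayerPointsOfEmb κ ι W 0) z₀ (c 0) = 0) : z₀ = 0 := by
  obtain ⟨hcneg, hc, hc0, -, -, hgen0, -⟩ := hH
  have hprime : p.Prime := Fact.out
  -- the integer `a_p - 2` is non-zero (`p ∣ a_p`, `p` an odd prime)
  have hne : (ap - 2 : ℤ) ≠ 0 := by
    intro h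
    have h2 : ap = 2 := by linarith
    rw [h2] at hap
    have hle2 := Int.le_of_dvd (by norm_num) hap
    have h2le := hprime.two_le
    omega
  refine hgen0 z₀ ?_
  have hmem0 : c 0 ∈ localLayerPointsOfEmb κ ι W 0 := hc 0
  have hsub : (⟨c 0, hmem0⟩ : localLayerPointsOfEmb κ ι W 0) = (ap - 2) • ⟨cneg, hcneg⟩ :=
    Subtype.ext (by rw [AddSubgroupClass.coe_zsmul]; exact hc0)
  rw [evalOn_of_mem W _ z₀ hmem0, hsub, map_zsmul, zsmul_eq_mul, mul_eq_zero] at hz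
  rcases hz with h | h
  · exact absurd (by exact_mod_cast h) hne
  · rwa [evalOn_of_mem W _ z₀ hcneg]

/-- **Sprung 2024 Lemma 5.5 (all `N`), either colour, at an odd supersingular prime — from Greenberg's Prop. 4.13
(Cassels), Prop. 4.12 and Kato's Thm. 12.4 BY NAME, plus kernel, MODULO the `⋆`-local lift at the place above `p`.**
`W/ℚ` elliptic, globally minimal, `p ≠ 2` of good supersingular reduction (`p ∣ a_p`); `κ` cyclotomic with
topological generator `γ`; `v ∋ p` with its embedding, `g` a local lift of a generator, `(cneg, c)` a Honda system
(Sprung 2012 Thm. 2.2), a colour `⋆`; `Σ₀` finite with good reduction off `Σ₀ ∪ {p}`. Assume the named facts `hC`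
(Prop. 4.13 / Cassels), `h412` (Prop. 4.12), `hWL` (§5 p. 140 = Kato Thm. 12.4) and the displayed `⋆`-local lift
`hlocp` at the place(s) `w ∋ p` (Greenberg p. 108 «for `v ∣ p`»). Then the body of
`Sprung2024.lem55AllN_sharpFlat_coinvariants_card` holds at these data:
`Sel_{p^∞}(E/ℚ)` finite ⇒ `(Sel⋆_∞)_γ` finite ⇒ `#ker g⋆ · #E(ℚ)[p^∞] = p^{ord_p ∏ c_ℓ} · #(Sel⋆_∞)_γ`. Indeed
`#E(ℚ)[p^∞] = 1` (`natCard_fixedPoints_geomPrimaryTorsion_eq_one_of_supersingular`), `#ker g⋆ = p^{ord_p ∏ c_ℓ}`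
(Cassels' count `SSFlatEC.natCard_flatKerG_eq_pow_of_casselsSurjectivity`, fed with «`Ker Col⋆` kills `E(ℚ_p)`»
= `colemanKer_apply_eq_zero_of_mem_localLayerPointsOfEmb_zero` and «`r_p` injective» =
`lem55AllN_sharpFlat_localKerOver_of_layerToInfty_mem_holds`), and `(Sel⋆_∞)_γ = 0`
(`SSFlatEC.sharpFlatEndCoinvariants_subsingleton_of_cassels_top`: Prop. 4.12 on the canonical finitely generated
dual datum of `H¹(ℚ_Σ/ℚ_∞, E[p^∞])` — `finite_dual_H1Sigma_holds`, rank `1` by `hWL`, `Y[T]` finite by the corank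
bound `h1Sigma_zpCorank_le_degree_holds_rat` + control + `finite_invariants_of_rank_eq_one_of_coinvariantsRank_le_one`
— Cassels for LIFT, the local lifts away from `p` by `localQuotient_restriction_surjective_holds`, at `p` by `hlocp`).
[cite: GreenbergLNM1716, §4 p. 104, Lemma 4.7 (pp. 107–108), Prop. 4.12, Prop. 4.13 / p. 122, pp. 119–120; §5 p. 140]
[cite: Sprung2024, §5.2 Lemma 5.5 (p. 40)] [cite: Kato2004Asterisque, Thm. 12.4]
[cite: Sprung2012, Thm. 2.2, Lemma 2.3, Def. 7.9–7.11] -/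
theorem sharpFlatCount_of_print_of_locp (hp2 : p ≠ 2) (hgoodp : W.HasGoodReductionAtPrime p)
    (hap : (p : ℤ) ∣ W.frobeniusTrace p) (κ : ZpExtension ℚ p) (hκ : κ.IsCyclotomic)
    {γ : Field.absoluteGaloisGroup ℚ} (hγ : κ.IsTopGenerator γ)
    {v : HeightOneSpectrum (𝓞 ℚ)} (hv : (p : 𝓞 ℚ) ∈ v.asIdeal)
    {g : Field.absoluteGaloisGroup (v.adicCompletion ℚ)}
    (hg : κ.IsTopGenerator (resGalOfEmb (closureEmb (K := ℚ) (v.adicCompletion ℚ)) g))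
    {cneg : localPoints W (v.adicCompletion ℚ)} {c : ℕ → localPoints W (v.adicCompletion ℚ)}
    (hH : IsHondaSystem κ (closureEmb (K := ℚ) (v.adicCompletion ℚ)) W (W.frobeniusTrace p) g cneg c)
    (col : Chroma) (S₀ : Finset (HeightOneSpectrum (𝓞 ℚ)))
    (hgood : ∀ w : HeightOneSpectrum (𝓞 ℚ), w ∉ S₀ → ((p : ℕ) : 𝓞 ℚ) ∉ w.asIdeal → W.HasGoodReductionAt w)
    -- PRINT BY NAME (three named facts; pp. 108 and 119–120 are theorems of the tree)
    (hC : Greenberg1999.casselsSurjectivity_H1Sigma ℚ)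
    (h412 : Greenberg1999.prop412_noFiniteSubmodule_H1Sigma_of_rank_one)
    (hWL : Greenberg1999.h1SigmaInfty_rank_eq_one)
    -- (LOC⋆): the single-place local lift at the place(s) above `p`, with the `⋆`-clause
    (hlocp : ∀ t ∈ unramifiedOutside κ.kerSubgroup (W.geomPrimaryTorsion p) p
        (↑S₀ : Set (HeightOneSpectrum (𝓞 ℚ))),
      (∀ σ : Field.absoluteGaloisGroup ℚ, W.conjH1 p κ.kerSubgroup σ t - t ∈
        sharpFlatSelmerInfty W κ (closureEmb (K := ℚ) (v.adicCompletion ℚ)) (W.frobeniusTrace p) g c col) →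
      ∀ w : HeightOneSpectrum (𝓞 ℚ), ((p : ℕ) : 𝓞 ℚ) ∈ w.asIdeal →
      ∃ xw : discreteH1 (localSubgroup (⊤ : Subgroup (Field.absoluteGaloisGroup ℚ)) (w.adicCompletion ℚ))
          (localPoints W (w.adicCompletion ℚ)),
        (∃ k : ℕ, p ^ k • xw = 0) ∧
        ∀ y : W.subgroupH1 p (⊤ : Subgroup (Field.absoluteGaloisGroup ℚ)),
          W.localResOver p ⊤ (w.adicCompletion ℚ) y = xw →
          t - W.resOfLe p (le_top : κ.kerSubgroup ≤ ⊤) y ∈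
              W.localKerOver p κ.kerSubgroup (w.adicCompletion ℚ) ∧
          (w = v → t - W.resOfLe p (le_top : κ.kerSubgroup ≤ ⊤) y ∈
            sharpFlatLocalKummerOverOfEmb W p κ.kerSubgroup (closureEmb (K := ℚ) (v.adicCompletion ℚ))
              (localTowerPointsOfEmb κ (closureEmb (K := ℚ) (v.adicCompletion ℚ)) W)
              (colemanKer κ (closureEmb (K := ℚ) (v.adicCompletion ℚ)) W (W.frobeniusTrace p) g c col))) :
    Finite (W.selmerGroupPInfty p) →
      Finite (EndCoinvariants (conjSharpFlatSelmerInfty W κ (closureEmb (K := ℚ) (v.adicCompletion ℚ))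
        (W.frobeniusTrace p) g c col γ - 1)) →
      Nat.card (↥((sharpFlatSelmerInfty W κ (closureEmb (K := ℚ) (v.adicCompletion ℚ))
            (W.frobeniusTrace p) g c col).comap (W.layerToInfty κ 0)) ⧸
          (W.selmerLayer κ 0).addSubgroupOf
            ((sharpFlatSelmerInfty W κ (closureEmb (K := ℚ) (v.adicCompletion ℚ))
              (W.frobeniusTrace p) g c col).comap (W.layerToInfty κ 0))) *
        Nat.card (MulAction.fixedPoints (Field.absoluteGaloisGroup ℚ) (W.geomPrimaryTorsion p)) =
      p ^ (padicValNat p W.tamagawaProduct) *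
        Nat.card (EndCoinvariants (conjSharpFlatSelmerInfty W κ
          (closureEmb (K := ℚ) (v.adicCompletion ℚ)) (W.frobeniusTrace p) g c col γ - 1)) := by
  have hv' : ((p : ℕ) : 𝓞 ℚ) ∈ v.asIdeal := by exact_mod_cast hv
  -- `#E(ℚ)[p^∞] = 1` at an odd supersingular prime
  have htors : Nat.card (MulAction.fixedPoints (Field.absoluteGaloisGroup ℚ) (W.geomPrimaryTorsion p)) = 1 :=
    natCard_fixedPoints_geomPrimaryTorsion_eq_one_of_supersingular W p hp2 hgoodp hap
  -- good reduction at the place `v ∋ p`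
  have hgoodv : W.HasGoodReductionAt v :=
    (hasGoodReductionAtPrime_primesEquiv_iff_holds W v p
      (Literature.NumberTheory.GaloisRepresentations.LocalField.primesEquiv_eq_of_natCast_mem p v hv')).mp hgoodp
  -- «`Ker Col⋆` kills `E(ℚ_p)`» and «`r_p` injective» (kdot theorems, both colours, odd `p`)
  have h𝒦 : ∀ z ∈ colemanKer κ (closureEmb (K := ℚ) (v.adicCompletion ℚ)) W (W.frobeniusTrace p) g c col,
      ∀ (x : localPoints W (v.adicCompletion ℚ))
        (hx : x ∈ localLayerPointsOfEmb κ (closureEmb (K := ℚ) (v.adicCompletion ℚ)) W 0),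
        z ⟨x, localLayerPointsOfEmb_le_localTowerPointsOfEmb κ _ W 0 hx⟩ = 0 := fun z hz x hx ↦
    colemanKer_apply_eq_zero_of_mem_localLayerPointsOfEmb_zero κ _ W hp2 hap hg hH col hz hx
  have hrp := lem55AllN_sharpFlat_localKerOver_of_layerToInfty_mem_holds W p hp2 hgoodp hap κ hκ v hv g hg
    cneg c hH col
  have hgood' : ∀ w : HeightOneSpectrum (𝓞 ℚ), w ∉ (↑S₀ : Set (HeightOneSpectrum (𝓞 ℚ))) →
      ((p : ℕ) : 𝓞 ℚ) ∉ w.asIdeal → W.HasGoodReductionAt w :=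
    fun w hw hpw ↦ hgood w (fun h ↦ hw (Finset.mem_coe.mpr h)) hpw
  refine sharpFlatCount_of_cassels_of_coinv W p κ γ g c col htors (fun hSel ↦ ?_) (fun hSel _ ↦ ?_)
  · -- Cassels' count, by name
    exact natCard_flatKerG_eq_pow_of_casselsSurjectivity W κ (W.frobeniusTrace p) g c col hC hκ hv' hgoodv
      h𝒦 hrp hSel htors
  · -- COINV⋆: the canonical dual datum of `H¹(ℚ_Σ/ℚ_∞, E[p^∞])` (tree), rank `1` (Kato 12.4 by name),
    -- `Y[T]` finite (pp. 119–120, tree), Prop. 4.12 by name, Cassels by name, local lifts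
    obtain ⟨Y, _instY₁, _instY₂, _instY₃, dY, hbij, hT, hCY⟩ :=
      Greenberg1999.finite_dual_H1Sigma_holds W p κ γ hκ hγ S₀ hgood
    have hrank : Module.rank (IwasawaAlgebra p) Y = 1 := hWL W p κ γ hκ hγ S₀ hgood Y dY hbij hT hCY
    have hco : coinvariantsRank p Y ≤ 1 := by
      rw [coinvariantsRank_eq_zpCorank_unramifiedOutside_top W κ hγ S₀.finite_toSet dY hbij hT hCY]
      have h := SignedEC.H1SigmaCorank.h1Sigma_zpCorank_le_degree_holds_rat W p hSel
        (↑S₀ : Set (HeightOneSpectrum (𝓞 ℚ))) S₀.finite_toSet hgood'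
      rwa [Module.finrank_self] at h
    have hfin : Finite (invariants p Y) :=
      IwasawaAlgebra.finite_invariants_of_rank_eq_one_of_coinvariantsRank_le_one p hrank hco
    have hY : ∀ N : Submodule (IwasawaAlgebra p) Y, Finite N → N = ⊥ :=
      h412 W p κ γ hκ hγ S₀ hgood Y dY hbij hT hCY hrank
    -- `Sel⋆_∞ ≤ Sel_∞ ≤ 𝒦_w` at every finite `w`
    have hSelle : ∀ w : HeightOneSpectrum (𝓞 ℚ),
        sharpFlatSelmerInfty W κ (closureEmb (K := ℚ) (v.adicCompletion ℚ)) (W.frobeniusTrace p) g c col ≤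
          W.localKerOver p κ.kerSubgroup (w.adicCompletion ℚ) := fun w s hs ↦ by
      have h1 := ((W.mem_selmerGroupOver_iff p κ.kerSubgroup s).1
        (sharpFlatSelmerInfty_le_selmerInfty W κ _ _ g c col hs)).1 w 1
      have hone : W.conjH1 p κ.kerSubgroup 1 = AddMonoidHom.id _ :=
        conjH1_of_mem_holds κ.kerSubgroup _ (one_mem _)
      rwa [hone, AddMonoidHom.id_apply] at h1
    haveI := sharpFlatEndCoinvariants_subsingleton_of_cassels_top W κ (W.frobeniusTrace p) g c col hκ hγ
      (↑S₀ : Set (HeightOneSpectrum (𝓞 ℚ))) hgood' hv'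
      (sharpFlatSelmerInfty_le_unramifiedOutside W κ (closureEmb (K := ℚ) (v.adicCompletion ℚ))
        (W.frobeniusTrace p) g c col _ hgood')
      dY hbij hT hCY hY hfin
      (fun x xi hx hxi ↦ hC W p hSel htors (↑S₀) (Finset.finite_toSet S₀) hgood' x xi hx hxi)
      (fun t ht hconj w _ ↦ by
        by_cases hpw : ((p : ℕ) : 𝓞 ℚ) ∈ w.asIdeal
        · exact hlocp t ht hconj w hpw
        · -- `w ∤ p`: Greenberg p. 108 (tree theorem), through part 13; the `⋆`-clause is vacuous
          obtain ⟨xw, hx, hmain⟩ := exists_localLift_of_localSurj W κ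
            (Greenberg1999.localQuotient_restriction_surjective_holds W p κ hκ w hpw) _ (hSelle w) t hconj
          refine ⟨xw, hx, fun y hy ↦ ⟨hmain y hy, fun hwv ↦ absurd ?_ hpw⟩⟩
          rw [hwv]
          exact hv')
    exact Nat.card_unique

/-- **LOC♭ at the place above `p` for a genuine Honda system, odd `p`** — the hypothesis `hlocp` of
`sharpFlatCount_of_print_of_locp` at `⋆ = ♭`, DISCHARGED: the place `w ∋ p` is `v` (`ℚ` has one prime above
`p`), Lemma 2.3 is `lem23_localTowerPoints_noPTorsion_holds`, the levels / `n ≥ 1` trace relation / level-`0`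
injectivity come from `IsHondaSystem` (`evalOn_layerZero_eq_zero_imp_of_isHondaSystem`), the ♭ lift is part 19
`SSFlatEC.exists_localLift_flat`, and the classical clause follows from the ♭ one (`E♭ ≤ Kummer ≤ 𝒦_w`).
[cite: GreenbergLNM1716, §4 proof of Lemma 4.7 (p. 108)] [cite: Sprung2012, Def. 7.9, Lemma 7.10, Lemma 2.3, Thm. 2.2] -/
theorem hlocp_flat_of_isHondaSystem (hp2 : p ≠ 2) (hgoodp : W.HasGoodReductionAtPrime p)
    (hap : (p : ℤ) ∣ W.frobeniusTrace p) (κ : ZpExtension ℚ p) (hκ : κ.IsCyclotomic)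
    {v : HeightOneSpectrum (𝓞 ℚ)} (hv : (p : 𝓞 ℚ) ∈ v.asIdeal)
    {g : Field.absoluteGaloisGroup (v.adicCompletion ℚ)}
    (hg : κ.IsTopGenerator (resGalOfEmb (closureEmb (K := ℚ) (v.adicCompletion ℚ)) g))
    {cneg : localPoints W (v.adicCompletion ℚ)} {c : ℕ → localPoints W (v.adicCompletion ℚ)}
    (hH : IsHondaSystem κ (closureEmb (K := ℚ) (v.adicCompletion ℚ)) W (W.frobeniusTrace p) g cneg c)
    (S₀ : Finset (HeightOneSpectrum (𝓞 ℚ))) :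
    ∀ t ∈ unramifiedOutside κ.kerSubgroup (W.geomPrimaryTorsion p) p
        (↑S₀ : Set (HeightOneSpectrum (𝓞 ℚ))),
      (∀ σ : Field.absoluteGaloisGroup ℚ, W.conjH1 p κ.kerSubgroup σ t - t ∈
        sharpFlatSelmerInfty W κ (closureEmb (K := ℚ) (v.adicCompletion ℚ)) (W.frobeniusTrace p) g c .flat) →
      ∀ w : HeightOneSpectrum (𝓞 ℚ), ((p : ℕ) : 𝓞 ℚ) ∈ w.asIdeal →
      ∃ xw : discreteH1 (localSubgroup (⊤ : Subgroup (Field.absoluteGaloisGroup ℚ)) (w.adicCompletion ℚ))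
          (localPoints W (w.adicCompletion ℚ)),
        (∃ k : ℕ, p ^ k • xw = 0) ∧
        ∀ y : W.subgroupH1 p (⊤ : Subgroup (Field.absoluteGaloisGroup ℚ)),
          W.localResOver p ⊤ (w.adicCompletion ℚ) y = xw →
          t - W.resOfLe p (le_top : κ.kerSubgroup ≤ ⊤) y ∈
              W.localKerOver p κ.kerSubgroup (w.adicCompletion ℚ) ∧
          (w = v → t - W.resOfLe p (le_top : κ.kerSubgroup ≤ ⊤) y ∈
            sharpFlatLocalKummerOverOfEmb W p κ.kerSubgroup (closureEmb (K := ℚ) (v.adicCompletion ℚ))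
              (localTowerPointsOfEmb κ (closureEmb (K := ℚ) (v.adicCompletion ℚ)) W)
              (colemanKer κ (closureEmb (K := ℚ) (v.adicCompletion ℚ)) W (W.frobeniusTrace p) g c .flat)) := by
  intro t _ hconj w hw
  have hwv : w = v :=
    HeightOneSpectrum.eq_of_natCast_mem_rat (Fact.out : p.Prime) hw (by exact_mod_cast hv)
  subst hwv
  -- Lemma 2.3 (tree theorem)
  have hnt : ∀ P ∈ localTowerPointsOfEmb κ (closureEmb (K := ℚ) (w.adicCompletion ℚ)) W, p • P = 0 → P = 0 :=
    fun P hP hpP ↦ lem23_localTowerPoints_noPTorsion_holds W p hp2 hgoodp hap κ hκ w hv P hP hpP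
  -- the Honda clauses used by the `p`-generic engine
  have hc : ∀ n, c n ∈ localLayerPointsOfEmb κ (closureEmb (K := ℚ) (w.adicCompletion ℚ)) W n := hH.2.1
  have hTr : ∀ n, 1 ≤ n → localTraceOfEmb κ (closureEmb (K := ℚ) (w.adicCompletion ℚ)) W n (n + 1)
      (c (n + 1)) = W.frobeniusTrace p • c n - c (n - 1) := hH.2.2.2.2.1
  have hinj : ∀ z₀ : localLayerPointsOfEmb κ (closureEmb (K := ℚ) (w.adicCompletion ℚ)) W 0 →+ ℤ_[p],
      evalOn W (localLayerPointsOfEmb κ (closureEmb (K := ℚ) (w.adicCompletion ℚ)) W 0) z₀ (c 0) = 0 →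
        z₀ = 0 :=
    fun z₀ hz ↦ evalOn_layerZero_eq_zero_imp_of_isHondaSystem W hp2 κ _ hap hH z₀ hz
  -- the ♭-condition on `conj_g t − t` (the `σ = 1` component of `Sel♭_∞`)
  have hone : W.conjH1 p κ.kerSubgroup 1 = AddMonoidHom.id _ :=
    W.conjH1_of_mem_holds p κ.kerSubgroup (one_mem _)
  have ht : W.conjH1 p κ.kerSubgroup (resGalOfEmb (closureEmb (K := ℚ) (w.adicCompletion ℚ)) g) t - t ∈
      sharpFlatLocalKummerOverOfEmb W p κ.kerSubgroup (closureEmb (K := ℚ) (w.adicCompletion ℚ))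
        (localTowerPointsOfEmb κ (closureEmb (K := ℚ) (w.adicCompletion ℚ)) W)
        (colemanKer κ (closureEmb (K := ℚ) (w.adicCompletion ℚ)) W (W.frobeniusTrace p) g c .flat) := by
    have h := ((mem_sharpFlatSelmerInfty_iff W κ _ _ g c .flat _).1
      (hconj (resGalOfEmb (closureEmb (K := ℚ) (w.adicCompletion ℚ)) g))).2 1
    rwa [hone, AddMonoidHom.id_apply] at h
  -- part 19 (the instance `CharZero ℚ_w` is passed as a term, as in the bsd-2adic file)
  obtain ⟨xw, hxw, hmain⟩ := @exists_localLift_flat ℚ _ _ W _ p _ κ (w.adicCompletion ℚ) _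
    (charZero_adicCompletion w) _ (W.frobeniusTrace p) hap g hg c hc hTr hinj hnt t ht
  refine ⟨xw, hxw, fun y hy ↦ ⟨?_, fun _ ↦ hmain y hy⟩⟩
  exact localKummerOverOfEmb_le_localKerOverOfEmb _
    (sharpFlatLocalKummerOverOfEmb_le_localKummerOverOfEmb _ _ (hmain y hy))

/-- **Sprung 2024 Lemma 5.5 (all `N`) at `(p, ♭)`, `p` odd supersingular — from the THREE named facts
{Prop. 4.13 (Cassels), Prop. 4.12, Kato Thm. 12.4} and the kernel, NOTHING displayed.** The body of
`Sprung2024.lem55AllN_sharpFlat_coinvariants_card` at colour `♭` (for any finite `Σ₀ ⊇` bad places: the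
conclusion does not mention `Σ₀`; take `Σ₀ =` the primes of bad reduction).
[cite: Sprung2024, §5.2 Lemma 5.5 (p. 40)] [cite: GreenbergLNM1716, §4 Lemma 4.7, Prop. 4.12, Prop. 4.13 / p. 122; §5 p. 140]
[cite: Kato2004Asterisque, Thm. 12.4] -/
theorem sharpFlatCount_flat_of_print (hp2 : p ≠ 2) (hgoodp : W.HasGoodReductionAtPrime p)
    (hap : (p : ℤ) ∣ W.frobeniusTrace p) (κ : ZpExtension ℚ p) (hκ : κ.IsCyclotomic)
    {γ : Field.absoluteGaloisGroup ℚ} (hγ : κ.IsTopGenerator γ)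
    {v : HeightOneSpectrum (𝓞 ℚ)} (hv : (p : 𝓞 ℚ) ∈ v.asIdeal)
    {g : Field.absoluteGaloisGroup (v.adicCompletion ℚ)}
    (hg : κ.IsTopGenerator (resGalOfEmb (closureEmb (K := ℚ) (v.adicCompletion ℚ)) g))
    {cneg : localPoints W (v.adicCompletion ℚ)} {c : ℕ → localPoints W (v.adicCompletion ℚ)}
    (hH : IsHondaSystem κ (closureEmb (K := ℚ) (v.adicCompletion ℚ)) W (W.frobeniusTrace p) g cneg c)
    (S₀ : Finset (HeightOneSpectrum (𝓞 ℚ)))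
    (hgood : ∀ w : HeightOneSpectrum (𝓞 ℚ), w ∉ S₀ → ((p : ℕ) : 𝓞 ℚ) ∉ w.asIdeal → W.HasGoodReductionAt w)
    (hC : Greenberg1999.casselsSurjectivity_H1Sigma ℚ)
    (h412 : Greenberg1999.prop412_noFiniteSubmodule_H1Sigma_of_rank_one)
    (hWL : Greenberg1999.h1SigmaInfty_rank_eq_one) :
    Finite (W.selmerGroupPInfty p) →
      Finite (EndCoinvariants (conjSharpFlatSelmerInfty W κ (closureEmb (K := ℚ) (v.adicCompletion ℚ))
        (W.frobeniusTrace p) g c .flat γ - 1)) →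
      Nat.card (↥((sharpFlatSelmerInfty W κ (closureEmb (K := ℚ) (v.adicCompletion ℚ))
            (W.frobeniusTrace p) g c .flat).comap (W.layerToInfty κ 0)) ⧸
          (W.selmerLayer κ 0).addSubgroupOf
            ((sharpFlatSelmerInfty W κ (closureEmb (K := ℚ) (v.adicCompletion ℚ))
              (W.frobeniusTrace p) g c .flat).comap (W.layerToInfty κ 0))) *
        Nat.card (MulAction.fixedPoints (Field.absoluteGaloisGroup ℚ) (W.geomPrimaryTorsion p)) =
      p ^ (padicValNat p W.tamagawaProduct) *
        Nat.card (EndCoinvariants (conjSharpFlatSelmerInfty W κ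
          (closureEmb (K := ℚ) (v.adicCompletion ℚ)) (W.frobeniusTrace p) g c .flat γ - 1)) :=
  sharpFlatCount_of_print_of_locp W p hp2 hgoodp hap κ hκ hγ hv hg hH .flat S₀ hgood hC h412 hWL
    (hlocp_flat_of_isHondaSystem W p hp2 hgoodp hap κ hκ hv hg hH S₀)

end Summit.BirchSwinnertonDyer.BirchSwinnertonDyer.Theorems.SharpFlatCount

end
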